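import Summits.CriticalPhenomena.PercolationContinuityZ3.Theorems.PercNearOneGluingNoHeavyLowerTailSahiGridPatternRoundingShared

/-!
# `NoHeavyLowerTail` (crux stmt-CriticalPhenomena-4575), Sahi programme P1: the rounding calculus, part 6 —
# **THE SWAP IDENTITIES FOR SHARED DESCENTS** (second-order rounding identities, every dimension)

Support file (seat `prim-sahi-p1`, generation 13; `--supports stmt-CriticalPhenomena-4575`).  Pure proofs, no definitions, no `sorry`,
standard axioms.  Vocabulary of `…SahiGridPatternRounding` (`axSwap`, `AxInv`, `lo`, `hi`, `roundUp`, `roundDown`, `rnd`) and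
`…SahiGridPatternRoundingLinear` (`sStarD_image_axSwap`, `ind_roundUp_add_roundDown`).

THE MATHEMATICS.  Fix an axis `a`, an adjacent level pair `(lo, hi) = (j, j+1)` and write `τ` for the value transposition `(lo hi)`
on axis `a` and `τX = X.image (axSwap a lo hi)` for the swapped set (NOT an up-set in general; `sStarD` is defined on all finsets).
Lieb–Sahi's linearity (part 2) says `S(A⁺,B,C) + S(A⁻,B,C) = 2·S(A,B,C)` when `B, C` are `τ`-invariant.  Here we drop the invariance:
* **`sStarD_roundUp_add_roundDown_eq_add_swap`**: for EVERY up-set `A` and all finsets `B, C`,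
  `S(A⁺,B,C) + S(A⁻,B,C) = S(A,B,C) + S(τA,B,C)` (pointwise `1_{A⁺} + 1_{A⁻} = 1_A + 1_{τA}` and linearity in the first slot);
  the same in the second and third slots.
* **`sum_four_roundings_eq`** (two sets rounded simultaneously): for up-sets `A, B` and any `C`,
  `Σ_{±,±} S(A^±,B^±,C) = S(A,B,C) + S(τA,B,C) + S(A,τB,C) + S(A,B,τC)`
  (bilinearity and the `τ`-invariance `S(τA,τB,C) = S(A,B,τC)` of the pattern functional, `sStarD_image_axSwap`).
* **`sum_eight_roundings_eq`** (all three rounded): for up-sets `A, B, C`,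
  `Σ_{±,±,±} S(A^±,B^±,C^±) = 2·[S(A,B,C) + S(τA,B,C) + S(A,τB,C) + S(A,B,τC)]`.
So the three SWAP DEFECTS `Δ_A = S(τA,B,C) − S(A,B,C)`, `Δ_B`, `Δ_C` (each vanishes when its set, or the other two sets, are
`τ`-invariant) govern the AVERAGE effect of the roundings at `(a, j)`: the two single roundings of `A` average to `S + Δ_A/2`, the four
pair roundings and the eight triple roundings both average to `S + (Δ_A+Δ_B+Δ_C)/4`.  Consequences (`exists_rnd_le_of_swap_le`,
`exists_rnd₂_le_of_swap_sum_le`, `exists_rnd₃_le_of_swap_sum_le`): a non-increasing rounding exists at `(a,j)` as soon as one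
swap defect of a rounded set is `≤ 0`, or the sum of the three is `≤ 0`; and in the two-active situation (`C` `τ`-invariant:
`sStarD_swap_third_eq_of_axInv`, `swap_first_eq_swap_second_of_axInv`) the two remaining defects coincide, so the only obstruction to the
rounding alternative at a shared level pair is a common STRICTLY CONVEX defect `S(τA,B,C) > S(A,B,C)`.  (Seat census, generation 13:
every failing level pair in the exhaustive `d = 3` list and in the known `d = 4` witnesses is of this two-active convex type; a
three-active failing pair exists at `d = 4`.)
HONEST LABEL: identities and sufficient conditions only; `RoundingAlternative d`, `PatternPos d` (`d ≥ 4`), Kahn's Conjecture 5 and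
Sahi's `C₃` remain OPEN and nothing here asserts them. [this work]
-/

namespace Summit.CriticalPhenomena.PercolationContinuityZ3.Theorems.SahiGridPattern

open Finset
open scoped Classical

variable {d : ℕ}

/-! ### Swapping twice, and moving swaps between slots -/

/-- `τ(τX) = X` for the value transposition on one axis. [this work] -/
theorem image_axSwap_image_axSwap (a : Fin d) (u v : Fin 3) (X : Finset (Pd d)) :
    (X.image (axSwap a u v)).image (axSwap a u v) = X := by
  have h : (axSwap a u v ∘ axSwap a u v : Pd d → Pd d) = id := by
    funext x; exact axSwap_axSwap a u v x
  simp only [Finset.image_image, h, Finset.image_id]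

/-- `S(τA, τB, C) = S(A, B, τC)`. [this work] -/
theorem sStarD_swap_swap_eq_third (a : Fin d) (u v : Fin 3) (A B C : Finset (Pd d)) :
    sStarD (A.image (axSwap a u v)) (B.image (axSwap a u v)) C = sStarD A B (C.image (axSwap a u v)) := by
  have h := sStarD_image_axSwap a u v (A.image (axSwap a u v)) (B.image (axSwap a u v)) C
  rw [image_axSwap_image_axSwap, image_axSwap_image_axSwap] at h
  exact h.symm

/-- `S(τA, B, τC) = S(A, τB, C)`. [this work] -/
theorem sStarD_swap_swap_eq_second (a : Fin d) (u v : Fin 3) (A B C : Finset (Pd d)) :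
    sStarD (A.image (axSwap a u v)) B (C.image (axSwap a u v)) = sStarD A (B.image (axSwap a u v)) C := by
  rw [sStarD_swap23, sStarD_swap_swap_eq_third, sStarD_swap23]

/-- `S(A, τB, τC) = S(τA, B, C)`. [this work] -/
theorem sStarD_swap_swap_eq_first (a : Fin d) (u v : Fin 3) (A B C : Finset (Pd d)) :
    sStarD A (B.image (axSwap a u v)) (C.image (axSwap a u v)) = sStarD (A.image (axSwap a u v)) B C := by
  rw [sStarD_swap12 A, sStarD_swap_swap_eq_second, sStarD_swap12]

/-- If `C` is `τ`-invariant, swapping it does nothing: `S(A,B,τC) = S(A,B,C)`. [this work] -/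
theorem sStarD_swap_third_eq_of_axInv {a : Fin d} {u v : Fin 3} (A B : Finset (Pd d)) {C : Finset (Pd d)}
    (hC : AxInv a u v C) : sStarD A B (C.image (axSwap a u v)) = sStarD A B C := by
  rw [image_axSwap_eq_of_axInv hC]

/-- Two-active situation: if `C` is `τ`-invariant then the swap defects of `A` and `B` coincide, `S(τA,B,C) = S(A,τB,C)`. [this work] -/
theorem swap_first_eq_swap_second_of_axInv {a : Fin d} {u v : Fin 3} (A B : Finset (Pd d)) {C : Finset (Pd d)}
    (hC : AxInv a u v C) : sStarD (A.image (axSwap a u v)) B C = sStarD A (B.image (axSwap a u v)) C := by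
  rw [← sStarD_swap_swap_eq_second, image_axSwap_eq_of_axInv hC]

/-! ### One set rounded: `S(A⁺) + S(A⁻) = S(A) + S(τA)` in each slot -/

/-- **First-slot swap identity** (Lieb–Sahi's Prop. 2.6 without the invariance hypothesis): for an up-set `A` and ANY `B, C`,
`sStarD (roundUp a j A) B C + sStarD (roundDown a j A) B C = sStarD A B C + sStarD (τA) B C`. [this work] -/
theorem sStarD_roundUp_add_roundDown_eq_add_swap (a : Fin d) (j : Fin 2) {A : Finset (Pd d)}
    (hA : IsUpperSet (A : Set (Pd d))) (B C : Finset (Pd d)) :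
    sStarD (roundUp a j A) B C + sStarD (roundDown a j A) B C =
      sStarD A B C + sStarD (A.image (axSwap a (lo j) (hi j))) B C := by
  rw [sStarD_eq_sum_ite (roundUp a j A), sStarD_eq_sum_ite (roundDown a j A), sStarD_eq_sum_ite A,
    sStarD_eq_sum_ite (A.image _), ← Finset.sum_add_distrib, ← Finset.sum_add_distrib]
  exact Finset.sum_congr rfl fun x _ => ind_roundUp_add_roundDown hA x _

/-- Second-slot swap identity. [this work] -/
theorem sStarD_roundUp_add_roundDown_eq_add_swap₂ (a : Fin d) (j : Fin 2) (A : Finset (Pd d)) {B : Finset (Pd d)}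
    (hB : IsUpperSet (B : Set (Pd d))) (C : Finset (Pd d)) :
    sStarD A (roundUp a j B) C + sStarD A (roundDown a j B) C =
      sStarD A B C + sStarD A (B.image (axSwap a (lo j) (hi j))) C := by
  rw [sStarD_swap12 A (roundUp a j B), sStarD_swap12 A (roundDown a j B), sStarD_swap12 A B,
    sStarD_swap12 A (B.image _)]
  exact sStarD_roundUp_add_roundDown_eq_add_swap a j hB A C

/-- Third-slot swap identity. [this work] -/
theorem sStarD_roundUp_add_roundDown_eq_add_swap₃ (a : Fin d) (j : Fin 2) (A B : Finset (Pd d)) {C : Finset (Pd d)}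
    (hC : IsUpperSet (C : Set (Pd d))) :
    sStarD A B (roundUp a j C) + sStarD A B (roundDown a j C) =
      sStarD A B C + sStarD A B (C.image (axSwap a (lo j) (hi j))) := by
  rw [sStarD_swap23 A B (roundUp a j C), sStarD_swap23 A B (roundDown a j C), sStarD_swap23 A B C,
    sStarD_swap23 A B (C.image _)]
  exact sStarD_roundUp_add_roundDown_eq_add_swap₂ a j A hC B

/-! ### Two and three sets rounded simultaneously -/

/-- **Pair swap identity**: for up-sets `A, B` and any `C`, the four simultaneous roundings of `A` and `B` at `(a,j)` sum to
`S(A,B,C) + S(τA,B,C) + S(A,τB,C) + S(A,B,τC)`. [this work] -/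
theorem sum_four_roundings_eq (a : Fin d) (j : Fin 2) {A B : Finset (Pd d)} (hA : IsUpperSet (A : Set (Pd d)))
    (hB : IsUpperSet (B : Set (Pd d))) (C : Finset (Pd d)) :
    sStarD (roundUp a j A) (roundUp a j B) C + sStarD (roundUp a j A) (roundDown a j B) C +
        sStarD (roundDown a j A) (roundUp a j B) C + sStarD (roundDown a j A) (roundDown a j B) C =
      sStarD A B C + sStarD (A.image (axSwap a (lo j) (hi j))) B C + sStarD A (B.image (axSwap a (lo j) (hi j))) C +
        sStarD A B (C.image (axSwap a (lo j) (hi j))) := by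
  have h1 := sStarD_roundUp_add_roundDown_eq_add_swap a j hA (roundUp a j B) C
  have h2 := sStarD_roundUp_add_roundDown_eq_add_swap a j hA (roundDown a j B) C
  have h3 := sStarD_roundUp_add_roundDown_eq_add_swap₂ a j A hB C
  have h4 := sStarD_roundUp_add_roundDown_eq_add_swap₂ a j (A.image (axSwap a (lo j) (hi j))) hB C
  have h5 := sStarD_swap_swap_eq_third a (lo j) (hi j) A B C
  linarith

/-- **Triple swap identity**: for up-sets `A, B, C`, the eight simultaneous roundings at `(a,j)` sum to
`2·[S(A,B,C) + S(τA,B,C) + S(A,τB,C) + S(A,B,τC)]`. [this work] -/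
theorem sum_eight_roundings_eq (a : Fin d) (j : Fin 2) {A B C : Finset (Pd d)} (hA : IsUpperSet (A : Set (Pd d)))
    (hB : IsUpperSet (B : Set (Pd d))) (hC : IsUpperSet (C : Set (Pd d))) :
    sStarD (roundUp a j A) (roundUp a j B) (roundUp a j C) + sStarD (roundUp a j A) (roundDown a j B) (roundUp a j C) +
        sStarD (roundDown a j A) (roundUp a j B) (roundUp a j C) + sStarD (roundDown a j A) (roundDown a j B) (roundUp a j C) +
      (sStarD (roundUp a j A) (roundUp a j B) (roundDown a j C) + sStarD (roundUp a j A) (roundDown a j B) (roundDown a j C) +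
        sStarD (roundDown a j A) (roundUp a j B) (roundDown a j C) +
          sStarD (roundDown a j A) (roundDown a j B) (roundDown a j C)) =
      2 * (sStarD A B C + sStarD (A.image (axSwap a (lo j) (hi j))) B C + sStarD A (B.image (axSwap a (lo j) (hi j))) C +
        sStarD A B (C.image (axSwap a (lo j) (hi j)))) := by
  have hU := sum_four_roundings_eq a j hA hB (roundUp a j C)
  have hD := sum_four_roundings_eq a j hA hB (roundDown a j C)
  have e1 := sStarD_roundUp_add_roundDown_eq_add_swap₃ a j A B hC
  have e2 := sStarD_roundUp_add_roundDown_eq_add_swap₃ a j (A.image (axSwap a (lo j) (hi j))) B hC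
  have e3 := sStarD_roundUp_add_roundDown_eq_add_swap₃ a j A (B.image (axSwap a (lo j) (hi j))) hC
  -- the third-slot identity for the swapped set `τC` (an up-set is not needed there: expand via the first two slots instead)
  have e4 : sStarD A B ((roundUp a j C).image (axSwap a (lo j) (hi j))) +
      sStarD A B ((roundDown a j C).image (axSwap a (lo j) (hi j))) =
        sStarD A B (C.image (axSwap a (lo j) (hi j))) + sStarD A B C := by
    rw [← sStarD_swap_swap_eq_third, ← sStarD_swap_swap_eq_third, ← sStarD_swap_swap_eq_third,
      ← sStarD_image_axSwap a (lo j) (hi j) A B C]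
    have := sStarD_roundUp_add_roundDown_eq_add_swap₃ a j (A.image (axSwap a (lo j) (hi j)))
      (B.image (axSwap a (lo j) (hi j))) hC
    rw [this, add_comm]
  have s1 := sStarD_swap_swap_eq_first a (lo j) (hi j) A B C
  have s2 := sStarD_swap_swap_eq_second a (lo j) (hi j) A B C
  linarith

/-! ### Sufficient conditions for a non-increasing rounding at `(a, j)` -/

/-- One set: if the swap defect of `A` is `≤ 0`, i.e. `S(τA,B,C) ≤ S(A,B,C)`, then one of the two roundings of `A` alone does not
increase the functional. [this work] -/
theorem exists_rnd_le_of_swap_le (a : Fin d) (j : Fin 2) {A : Finset (Pd d)} (hA : IsUpperSet (A : Set (Pd d)))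
    {B C : Finset (Pd d)} (h : sStarD (A.image (axSwap a (lo j) (hi j))) B C ≤ sStarD A B C) :
    ∃ s : Bool, sStarD (rnd s a j A) B C ≤ sStarD A B C := by
  have hsum := sStarD_roundUp_add_roundDown_eq_add_swap a j hA B C
  by_cases hle : sStarD (roundUp a j A) B C ≤ sStarD A B C
  · exact ⟨true, by rw [rnd_true]; exact hle⟩
  · exact ⟨false, by rw [rnd_false]; linarith⟩

/-- Two sets: if `S(τA,B,C) + S(A,τB,C) + S(A,B,τC) ≤ 3·S(A,B,C)` then one of the four simultaneous roundings of `A` and `B`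
(with `C` untouched) does not increase the functional. [this work] -/
theorem exists_rnd₂_le_of_swap_sum_le (a : Fin d) (j : Fin 2) {A B : Finset (Pd d)} (hA : IsUpperSet (A : Set (Pd d)))
    (hB : IsUpperSet (B : Set (Pd d))) {C : Finset (Pd d)}
    (h : sStarD (A.image (axSwap a (lo j) (hi j))) B C + sStarD A (B.image (axSwap a (lo j) (hi j))) C +
      sStarD A B (C.image (axSwap a (lo j) (hi j))) ≤ 3 * sStarD A B C) :
    ∃ sA sB : Bool, sStarD (rnd sA a j A) (rnd sB a j B) C ≤ sStarD A B C := by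
  have hsum := sum_four_roundings_eq a j hA hB C
  by_contra hne
  push Not at hne
  have h1 := hne true true; have h2 := hne true false; have h3 := hne false true; have h4 := hne false false
  simp only [rnd_true, rnd_false] at h1 h2 h3 h4
  linarith

/-- Three sets: if `S(τA,B,C) + S(A,τB,C) + S(A,B,τC) ≤ 3·S(A,B,C)` then one of the eight simultaneous roundings at `(a,j)` does
not increase the functional (the averaged form of the rounding alternative at `(a,j)`). [this work] -/
theorem exists_rnd₃_le_of_swap_sum_le (a : Fin d) (j : Fin 2) {A B C : Finset (Pd d)} (hA : IsUpperSet (A : Set (Pd d)))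
    (hB : IsUpperSet (B : Set (Pd d))) (hC : IsUpperSet (C : Set (Pd d)))
    (h : sStarD (A.image (axSwap a (lo j) (hi j))) B C + sStarD A (B.image (axSwap a (lo j) (hi j))) C +
      sStarD A B (C.image (axSwap a (lo j) (hi j))) ≤ 3 * sStarD A B C) :
    ∃ sA sB sC : Bool, sStarD (rnd sA a j A) (rnd sB a j B) (rnd sC a j C) ≤ sStarD A B C := by
  have hsum := sum_eight_roundings_eq a j hA hB hC
  by_contra hne
  push Not at hne
  have h1 := hne true true true; have h2 := hne true false true; have h3 := hne false true true
  have h4 := hne false false true; have h5 := hne true true false; have h6 := hne true false false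
  have h7 := hne false true false; have h8 := hne false false false
  simp only [rnd_true, rnd_false] at h1 h2 h3 h4 h5 h6 h7 h8
  linarith

/-- **Two-active form.**  If `C` is `(lo hi)`-invariant on axis `a` (no descent of `C` at this level pair) then the averaged criterion
reads `S(τA,B,C) ≤ S(A,B,C)`: a shared descent of `A` and `B` with non-positive common swap defect admits a non-increasing simultaneous
rounding of the three sets at `(a,j)`. [this work] -/
theorem exists_rnd₃_le_of_axInv_of_swap_le (a : Fin d) (j : Fin 2) {A B C : Finset (Pd d)} (hA : IsUpperSet (A : Set (Pd d)))
    (hB : IsUpperSet (B : Set (Pd d))) (hC : IsUpperSet (C : Set (Pd d))) (hCinv : AxInv a (lo j) (hi j) C)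
    (h : sStarD (A.image (axSwap a (lo j) (hi j))) B C ≤ sStarD A B C) :
    ∃ sA sB sC : Bool, sStarD (rnd sA a j A) (rnd sB a j B) (rnd sC a j C) ≤ sStarD A B C := by
  refine exists_rnd₃_le_of_swap_sum_le a j hA hB hC ?_
  rw [sStarD_swap_third_eq_of_axInv A B hCinv, ← swap_first_eq_swap_second_of_axInv A B hCinv]
  linarith

/-- Conversely, in the two-active situation the common swap defect is the exact average excess of the roundings: if all eight
simultaneous roundings at `(a,j)` strictly increase the functional then `S(τA,B,C) > S(A,B,C)` (a STRICTLY CONVEX shared descent) —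
the only local obstruction to the rounding alternative at a level pair owned by two sets. [this work] -/
theorem swap_gt_of_forall_rnd₃_gt (a : Fin d) (j : Fin 2) {A B C : Finset (Pd d)} (hA : IsUpperSet (A : Set (Pd d)))
    (hB : IsUpperSet (B : Set (Pd d))) (hC : IsUpperSet (C : Set (Pd d))) (hCinv : AxInv a (lo j) (hi j) C)
    (h : ∀ sA sB sC : Bool, sStarD A B C < sStarD (rnd sA a j A) (rnd sB a j B) (rnd sC a j C)) :
    sStarD A B C < sStarD (A.image (axSwap a (lo j) (hi j))) B C := by
  by_contra hle
  push Not at hle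
  obtain ⟨sA, sB, sC, hs⟩ := exists_rnd₃_le_of_axInv_of_swap_le a j hA hB hC hCinv hle
  exact absurd (h sA sB sC) (not_lt.2 hs)

end Summit.CriticalPhenomena.PercolationContinuityZ3.Theorems.SahiGridPattern
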